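import Literature.MathematicalPhysics.QuantumLattice.SpinSectorPartitionFnRelabel
import Literature.MathematicalPhysics.QuantumLattice.HubbardNNNHoppingRectSymmetries
import Literature.MathematicalPhysics.QuantumLattice.HubbardNNNHoppingOpenClusters
import Literature.MathematicalPhysics.QuantumLattice.ApproximatingHamiltonianProofs
import Literature.MathematicalPhysics.QuantumLattice.TorusSectorGibbsOpenBoxBound
import HarnessLib

/-!
# Canonical (spin-sector) partition functions under the particle–hole transformation:
# hole doping at `t'` is electron doping at `-t'` — at every temperature

Family `hubbard` (topic `MathematicalPhysics/QuantumLattice`); seat `hubbard-downfold-unc-2` (cell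
`pub/hubbard-downfold`, row «FILLING direction of BOX → WORD»: this file is the ELECTRON-DOPED half of the
filling axis at `T > 0`). Companion of `SpinSectorPartitionFnRelabel` (canonical partition functions
`Z_β(A; a, b) = Z_β(spinSectorHamiltonian a b A) = tr_{(a,b)} e^{-βA}` are invariant under SITE
bijections) and of `HubbardNNNHoppingParticleHole` / `HubbardNNNHoppingRectSymmetries` (the `T = 0`
dictionary: Lieb's particle–hole unitary `P = particleHole ε'`, `P c_{xσ} Pᴴ = ε_x c†_{xσ}`, maps the
`t–t'` Hubbard Hamiltonian of a bipartite cluster to `H(t, -t', U) - U N + U|Λ|` and the sector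
ground-state energies accordingly). Here the same unitary is followed through the CANONICAL PARTITION
FUNCTIONS of every spin sector `(N↑, N↓) = (a, b)`:

* §1 (any finite orbital set, any unimodular phases `ε'`): `P` maps the sector `(a, b)` onto the sector
  `(|Λ| - a, |Λ| - b)` (`spinConfig_compl_iff`, configurations `s ↦ sᶜ`), the compression of `P A Pᴴ` to
  the image sector is the compression of `A` to the source sector conjugated by the diagonal unimodular
  weights of `P` and reindexed along `s ↦ sᶜ` (`spinSectorHamiltonian_particleHole_conj`), hence
  `Z_β(P A Pᴴ; |Λ| - a, |Λ| - b) = Z_β(A; a, b)` (`partitionFn_spinSectorHamiltonian_particleHole_conj`);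
  and the TWO-OPERATOR TRANSFER: if `P A Pᴴ = A' - U N + c`, then
  `Z_β(A; a, b) = e^{-β(c - U(a' + b'))} · Z_β(A'; a', b')` with `a + a' = b + b' = |Λ|`
  (`partitionFn_spinSectorHamiltonian_particleHole_transfer`; the sector compression of `N` is the
  scalar `a' + b'`).
* §2 THE OPEN `a × b` CLUSTER, ANY SIDES (free boundary conditions are bipartite for the nearest-neighbour
  bonds, and the diagonal bonds join equal-sign sites): `P H^{open}(t, t', U) Pᴴ = H^{open}(t, -t', U) - U N
  + U ab` (`particleHole_hubbardOpenBoxTT'`) and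
  `Z_β(H^{open}_{a×b}(t, t', U); p, q) = e^{βU(ab - p - q)} · Z_β(H^{open}_{a×b}(t, -t', U); ab - p, ab - q)`
  (`partitionFn_spinSector_hubbardOpenBoxTT'_particleHole`, real-part form `…_re`, floor-transfer form
  `mul_le_partitionFn_spinSector_hubbardOpenBoxTT'_re_of_particleHole`). CONSUMER: the inputs of the
  type-class pressure floor `TorusSectorPressureTypeBoundAllTori` are exactly such open-box sector
  partition functions — a HOLE-doped sidecar of `H^{open}(t, -t', U)` IS an ELECTRON-doped sidecar of
  `H^{open}(t, t', U)`, for every torus (the all-tori floor needs no torus particle–hole symmetry). The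
  uniform-sign conjugation (`(t, t') ↦ (-t, -t')`, any cluster) gives
  `partitionFn_spinSector_hubbardOpenBoxTT'_particleHole_uniform`, and composing the two:
  **the sign of `t` is immaterial for every open-box canonical partition function**
  (`partitionFn_spinSector_hubbardOpenBoxTT'_neg_t`, any `a, b`).
* §3 TORI WITH EVEN SIDES (`hubbardRectTorusTT' a b`, `a, b` even; the square torus `hubbardTorusTT' L`,
  `L` even, incl. the canonical sector of record `sectorHamiltonianTT' t t' U n L` whose image is the spin
  sector `(L² - k, L² - k)`, `k = halfRectN n L` — which is the sector of record at density `2 - n` exactly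
  when `n L²/2 ∈ ℤ`, `partitionFn_sectorHamiltonianTT'_particleHole_of_add`).

Everything is PROVED (finite-dimensional algebra over the tree's Jordan–Wigner matrices); no definition, no named fact, no sorry
(the configuration bijection `s ↦ sᶜ` is written inline).
HONEST LIMITS: exact identities only; odd tori are not bipartite (no torus statement there — the open-box
statement is what the all-tori pressure floors consume); nothing about states (the particle–hole map of
torus-limit STATES is a separate file).

## References

* E. H. Lieb, F. Y. Wu, Physica A 321 (2003) 1, §1 eq. (3) (`E(M, M') = -(N_a - N)U + E(N_a - M, N_a - M')`:
  the spin-resolved particle–hole map of the sectors `(M, M') ↦ (N_a - M, N_a - M')`; here for `tr e^{-βH}`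
  instead of the lowest eigenvalue). [cite: LiebWuPhysicaA2003, §1 eq. (3)]
* F. H. L. Essler, H. Frahm, F. Göhmann, A. Klümper, V. E. Korepin, *The One-Dimensional Hubbard Model*
  (2005), §2.2.4 eqs. (2.59)–(2.61) and the remark after (2.60) (same-sign bonds pick up a minus sign;
  `N`-electron eigenstates ↦ `(2L - N)`-electron eigenstates). [cite: EsslerEtAl2005, §2.2.4 eqs. (2.59)–(2.61)]
* H. Q. Lin, J. E. Hirsch, Phys. Rev. B 35 (1987) 3359 (`t' ↦ -t'` under the transformation: hole doping at
  `t'` vs electron doping at `-t'`). [cite: LinHirsch1987]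
* E. H. Lieb, Phys. Rev. Lett. 62 (1989) 1201, proof of Theorem 1 (the `(N↑, N↓)` sectors; the
  particle–hole unitary on a bipartite lattice). [cite: LiebPRL1989, proof of Theorem 1]
* O. Bratteli, D. W. Robinson, *Operator Algebras and Quantum Statistical Mechanics II* (1997), §5.2.2
  Thm. 5.2.5 (Bogoliubov transformations are unitarily implemented on Fock space).
  [cite: BratteliRobinsonII1997, §5.2.2, Thm. 5.2.5]

## Mathlib / tree search

REUSED: `particleHole`, `particleHole_apply`, `particleHoleWeight_mul_star` (`HubbardModelParticleHoleProofs`);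
`hamiltonian_particleHole_bipartite_holds` (`HubbardModelParticleHoleProofs`), `hamiltonian_particleHole_sameSign`,
`particleHole_hubbardTorusTT'` (`HubbardNNNHoppingParticleHole`), `particleHole_hubbardRectTorusTT'`, `rectStagger`
(`HubbardNNNHoppingRectSymmetries`); `spinConfig`, `spinSectorHamiltonian` (`SectorPartitionFnCut`); `upPart`,
`downPart`, `card_eq_upPart_add_downPart` (`HubbardLiebConfig`); `Matrix.partitionFn_unitary_conj` (`DuhamelTwoPoint`),
`Matrix.partitionFn_submatrix_equiv` (`HalfFillingGaussianDomination`), `partitionFn_add_smul_one`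
(`ApproximatingHamiltonianProofs`); `totalNumberOp_eq_diagonal` / `totalNumberOp_eq_totalNumber` (`FermionOperators`);
`hubbardOpenBoxTT'`, `rectBoxGraph`, `rectBoxDiagGraph` (`HubbardNNNHoppingOpenClusters`); `sectorHamiltonianTT'`,
`halfRectN`, `partitionFn_sectorHamiltonianTT'_eq_spinSector`, `partitionFn_spinSector_hubbardTorusTT'_eq_rect` (`TorusSectorGibbsOpenBoxBound`). `lean search 'partitionFn.*particleHole'`,
`'spinSector.*particleHole'`: no prior decl (the `T = 0` files transport `groundEnergy` only).
-/

noncomputable section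

namespace Literature.MathematicalPhysics.QuantumLattice

open Matrix Finset HubbardWave0 ThermodynamicLimit LiebThm1
open scoped ComplexOrder BigOperators

/-! ### §1 The particle–hole map of the spin sectors and of the sector compressions -/

section MatrixTransport

variable {m : Type*} [Fintype m] [DecidableEq m]

/-- Conjugation by a diagonal matrix of UNIMODULAR phases (`dᵢ · conj dᵢ = 1`) leaves the partition function
invariant (a diagonal unitary; the `±1` case is `partitionFn_diagonal_conj`).
[cite: BratteliRobinsonII1997, §5.2.2, Thm. 5.2.5] -/
theorem partitionFn_diagonal_conj_unimodular (β : ℝ) (A : Matrix m m ℂ) {d : m → ℂ}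
    (hd : ∀ i, d i * star (d i) = 1) :
    partitionFn β (diagonal d * A * diagonal (fun i => star (d i))) = partitionFn β A := by
  have hstar : star (diagonal d) = diagonal (fun i => star (d i)) := by
    rw [star_eq_conjTranspose, diagonal_conjTranspose]
    rfl
  have hd' : ∀ i, star (d i) * d i = 1 := fun i => by rw [mul_comm]; exact hd i
  have hU : diagonal d ∈ unitary (Matrix m m ℂ) := by
    rw [Unitary.mem_iff, hstar, diagonal_mul_diagonal, diagonal_mul_diagonal, ← diagonal_one]
    exact ⟨by congr 1; funext i; exact hd' i, by congr 1; funext i; exact hd i⟩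
  have h := partitionFn_unitary_conj hU β A
  rwa [hstar] at h

end MatrixTransport

section Sectors

variable {Λ : Type*} [LinearOrder Λ] [Fintype Λ]

/-- The up-spin sites of the complementary configuration are the complement of the up-spin sites:
`upPart sᶜ = (upPart s)ᶜ`. [cite: LiebWuPhysicaA2003, §1 eq. (3)] -/
theorem upPart_compl (s : Finset (Orb Λ)) : upPart sᶜ = (upPart s)ᶜ := by
  ext x
  simp [mem_upPart]

/-- The down-spin sites of the complementary configuration: `downPart sᶜ = (downPart s)ᶜ`.
[cite: LiebWuPhysicaA2003, §1 eq. (3)] -/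
theorem downPart_compl (s : Finset (Orb Λ)) : downPart sᶜ = (downPart s)ᶜ := by
  ext x
  simp [mem_downPart]

/-- **Complementation maps the spin sector `(a, b)` onto the sector `(a', b')` with
`a + a' = b + b' = |Λ|`** (`(M, M') ↦ (N_a - M, N_a - M')`). [cite: LiebWuPhysicaA2003, §1 eq. (3)] -/
theorem spinConfig_compl_iff {a b a' b' : ℕ} (ha : a + a' = Fintype.card Λ) (hb : b + b' = Fintype.card Λ)
    (s : Finset (Orb Λ)) : spinConfig a' b' sᶜ ↔ spinConfig a b s := by
  simp only [spinConfig, upPart_compl, downPart_compl, Finset.card_compl]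
  have h1 := (upPart s).card_le_univ
  have h2 := (downPart s).card_le_univ
  omega

/-- On a spin sector the particle number is the scalar `a + b`: the compression of
`A - U N + c` to the sector `(a, b)` is the compression of `A` shifted by `c - U(a + b)`.
[cite: LiebPRL1989, proof of Theorem 1] -/
theorem spinSectorHamiltonian_sub_smul_totalNumber_add_smul_one (a b : ℕ)
    (A : Matrix (Finset (Orb Λ)) (Finset (Orb Λ)) ℂ) (U c : ℂ) :
    spinSectorHamiltonian a b (A - U • totalNumber + c • (1 : Matrix (Finset (Orb Λ)) (Finset (Orb Λ)) ℂ)) =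
      spinSectorHamiltonian a b A +
        (c - U * ((a : ℂ) + b)) • (1 : Matrix (Subtype (spinConfig (Λ := Λ) a b))
          (Subtype (spinConfig (Λ := Λ) a b)) ℂ) := by
  ext i j
  rw [← totalNumberOp_eq_totalNumber, totalNumberOp_eq_diagonal]
  simp only [spinSectorHamiltonian, submatrix_apply, Matrix.add_apply, Matrix.sub_apply, Matrix.smul_apply,
    diagonal_apply, Matrix.one_apply, smul_eq_mul]
  by_cases h : i = j
  · subst h
    have hc : ((i.1.card : ℕ) : ℂ) = (a : ℂ) + b := by
      rw [card_eq_upPart_add_downPart i.1, i.2.1, i.2.2, Nat.cast_add]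
    rw [if_pos rfl, if_pos rfl, if_pos rfl, hc]
    ring
  · have h' : (i : Finset (Orb Λ)) ≠ (j : Finset (Orb Λ)) := fun e => h (Subtype.ext e)
    rw [if_neg h', if_neg h', if_neg h]
    ring

/-- The entries of a particle–hole conjugate: `(P A Pᴴ)(t, t') = w(tᶜ) · A(tᶜ, t'ᶜ) · conj w(t'ᶜ)` with the
weights `w(s) = ∏_{i ∈ s} conj(ε' i) · jwSign i univ` of `P |s⟩ = w(s) |sᶜ⟩`.
[cite: BratteliRobinsonII1997, §5.2.2, Thm. 5.2.5] -/
theorem particleHole_mul_mul_conjTranspose_apply (ε : Orb Λ → ℂ)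
    (A : Matrix (Finset (Orb Λ)) (Finset (Orb Λ)) ℂ) (t t' : Finset (Orb Λ)) :
    (particleHole ε * A * (particleHole ε)ᴴ) t t' =
      (∏ i ∈ tᶜ, star (ε i) * jwSign i univ) * A tᶜ t'ᶜ * star (∏ i ∈ t'ᶜ, star (ε i) * jwSign i univ) := by
  have hPA : ∀ j, (particleHole ε * A) t j = (∏ i ∈ tᶜ, star (ε i) * jwSign i univ) * A tᶜ j := by
    intro j
    rw [Matrix.mul_apply]
    have h : ∀ s, particleHole ε t s * A s j =
        if tᶜ = s then (∏ i ∈ tᶜ, star (ε i) * jwSign i univ) * A tᶜ j else 0 := by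
      intro s
      rw [particleHole_apply]
      by_cases hs : tᶜ = s
      · subst hs
        rw [if_pos (compl_compl t).symm, if_pos rfl]
      · rw [if_neg (fun h' => hs (by rw [h', compl_compl])), if_neg hs, zero_mul]
    simp only [h, Finset.sum_ite_eq, Finset.mem_univ, if_true]
  rw [Matrix.mul_apply]
  have h : ∀ j, (particleHole ε * A) t j * (particleHole ε)ᴴ j t' =
      if t'ᶜ = j then (∏ i ∈ tᶜ, star (ε i) * jwSign i univ) * A tᶜ t'ᶜ *
        star (∏ i ∈ t'ᶜ, star (ε i) * jwSign i univ) else 0 := by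
    intro j
    rw [hPA, conjTranspose_apply, particleHole_apply]
    by_cases hj : t'ᶜ = j
    · subst hj
      rw [if_pos (compl_compl t').symm, if_pos rfl]
    · rw [if_neg (fun h' => hj (by rw [h', compl_compl])), if_neg hj, star_zero, mul_zero]
  simp only [h, Finset.sum_ite_eq, Finset.mem_univ, if_true]

/-- **The compression of `P A Pᴴ` to the image sector** `(a', b')` is the compression of `A` to the source
sector `(a, b)`, conjugated by the diagonal matrix of the (unimodular) weights of `P` and reindexed along
`s ↦ sᶜ`. [cite: BratteliRobinsonII1997, §5.2.2, Thm. 5.2.5] -/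
theorem spinSectorHamiltonian_particleHole_conj (ε : Orb Λ → ℂ) {a b a' b' : ℕ}
    (ha : a + a' = Fintype.card Λ) (hb : b + b' = Fintype.card Λ)
    (A : Matrix (Finset (Orb Λ)) (Finset (Orb Λ)) ℂ) :
    spinSectorHamiltonian a' b' (particleHole ε * A * (particleHole ε)ᴴ) =
      (diagonal (fun c : Subtype (spinConfig (Λ := Λ) a b) => ∏ i ∈ c.1, star (ε i) * jwSign i univ) *
          spinSectorHamiltonian a b A *
          diagonal (fun c : Subtype (spinConfig (Λ := Λ) a b) =>
            star (∏ i ∈ c.1, star (ε i) * jwSign i univ))).submatrix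
        (fun c : Subtype (spinConfig (Λ := Λ) a' b') =>
          (⟨c.1ᶜ, (spinConfig_compl_iff ((Nat.add_comm a' a).trans ha) ((Nat.add_comm b' b).trans hb) c.1).2 c.2⟩ :
            Subtype (spinConfig (Λ := Λ) a b)))
        (fun c : Subtype (spinConfig (Λ := Λ) a' b') =>
          (⟨c.1ᶜ, (spinConfig_compl_iff ((Nat.add_comm a' a).trans ha) ((Nat.add_comm b' b).trans hb) c.1).2 c.2⟩ :
            Subtype (spinConfig (Λ := Λ) a b))) := by
  ext c d
  rw [submatrix_apply, mul_diagonal, diagonal_mul, spinSectorHamiltonian, submatrix_apply,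
    spinSectorHamiltonian, submatrix_apply, particleHole_mul_mul_conjTranspose_apply]

/-- **Canonical partition functions under the particle–hole unitary**:
`Z_β(P A Pᴴ; a', b') = Z_β(A; a, b)` for `a + a' = b + b' = |Λ|` and unimodular phases.
[cite: LiebWuPhysicaA2003, §1 eq. (3)] -/
theorem partitionFn_spinSectorHamiltonian_particleHole_conj (ε : Orb Λ → ℂ) (hε : ∀ i, ‖ε i‖ = 1)
    {a b a' b' : ℕ} (ha : a + a' = Fintype.card Λ) (hb : b + b' = Fintype.card Λ) (β : ℝ)
    (A : Matrix (Finset (Orb Λ)) (Finset (Orb Λ)) ℂ) :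
    partitionFn β (spinSectorHamiltonian a' b' (particleHole ε * A * (particleHole ε)ᴴ)) =
      partitionFn β (spinSectorHamiltonian a b A) := by
  rw [spinSectorHamiltonian_particleHole_conj ε ha hb]
  -- the reindexing `s ↦ sᶜ` is a bijection of the sector configurations (local, no definition)
  let e : Subtype (spinConfig (Λ := Λ) a' b') ≃ Subtype (spinConfig (Λ := Λ) a b) :=
    { toFun := fun c =>
        ⟨c.1ᶜ, (spinConfig_compl_iff ((Nat.add_comm a' a).trans ha) ((Nat.add_comm b' b).trans hb) c.1).2 c.2⟩
      invFun := fun c => ⟨c.1ᶜ, (spinConfig_compl_iff ha hb c.1).2 c.2⟩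
      left_inv := fun c => Subtype.ext (compl_compl c.1)
      right_inv := fun c => Subtype.ext (compl_compl c.1) }
  have h1 := partitionFn_submatrix_equiv β
    (diagonal (fun c : Subtype (spinConfig (Λ := Λ) a b) => ∏ i ∈ c.1, star (ε i) * jwSign i univ) *
      spinSectorHamiltonian a b A *
      diagonal (fun c : Subtype (spinConfig (Λ := Λ) a b) => star (∏ i ∈ c.1, star (ε i) * jwSign i univ))) e
  rw [partitionFn_diagonal_conj_unimodular β _ (fun c => particleHoleWeight_mul_star ε hε c.1)] at h1
  exact h1

/-- **The two-operator transfer for canonical partition functions.** If `P A Pᴴ = A' - U N + c · 1`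
(unimodular phases), then for `a + a' = b + b' = |Λ|`:
`Z_β(A; a, b) = e^{-β(c - U(a' + b'))} · Z_β(A'; a', b')` — the finite-temperature analogue of
`groundEnergy_particleHole_transfer` (`E_A(2|Λ| - N) = E_{A'}(N) - U N + c`).
[cite: LiebWuPhysicaA2003, §1 eq. (3)] -/
theorem partitionFn_spinSectorHamiltonian_particleHole_transfer (ε : Orb Λ → ℂ) (hε : ∀ i, ‖ε i‖ = 1)
    {A A' : Matrix (Finset (Orb Λ)) (Finset (Orb Λ)) ℂ} {U c : ℝ}
    (hconj : particleHole ε * A * (particleHole ε)ᴴ =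
      A' - (U : ℂ) • totalNumber + (c : ℂ) • (1 : Matrix (Finset (Orb Λ)) (Finset (Orb Λ)) ℂ))
    {a b a' b' : ℕ} (ha : a + a' = Fintype.card Λ) (hb : b + b' = Fintype.card Λ) (β : ℝ) :
    partitionFn β (spinSectorHamiltonian a b A) =
      (Real.exp (-(β * (c - U * (a' + b')))) : ℂ) * partitionFn β (spinSectorHamiltonian a' b' A') := by
  rw [← partitionFn_spinSectorHamiltonian_particleHole_conj ε hε ha hb β A, hconj,
    spinSectorHamiltonian_sub_smul_totalNumber_add_smul_one]
  have hcast : ((c : ℂ) - (U : ℂ) * ((a' : ℂ) + b')) = ((c - U * (a' + b') : ℝ) : ℂ) := by push_cast; ring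
  rw [hcast, partitionFn_add_smul_one]

/-- Real-part form of the transfer (canonical partition functions of Hermitian matrices are real):
`Re Z_β(A; a, b) = e^{-β(c - U(a' + b'))} · Re Z_β(A'; a', b')`. [cite: LiebWuPhysicaA2003, §1 eq. (3)] -/
theorem partitionFn_spinSectorHamiltonian_particleHole_transfer_re (ε : Orb Λ → ℂ) (hε : ∀ i, ‖ε i‖ = 1)
    {A A' : Matrix (Finset (Orb Λ)) (Finset (Orb Λ)) ℂ} {U c : ℝ}
    (hconj : particleHole ε * A * (particleHole ε)ᴴ =
      A' - (U : ℂ) • totalNumber + (c : ℂ) • (1 : Matrix (Finset (Orb Λ)) (Finset (Orb Λ)) ℂ))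
    {a b a' b' : ℕ} (ha : a + a' = Fintype.card Λ) (hb : b + b' = Fintype.card Λ) (β : ℝ) :
    (partitionFn β (spinSectorHamiltonian a b A)).re =
      Real.exp (-(β * (c - U * (a' + b')))) * (partitionFn β (spinSectorHamiltonian a' b' A')).re := by
  rw [partitionFn_spinSectorHamiltonian_particleHole_transfer ε hε hconj ha hb β, Complex.re_ofReal_mul]

end Sectors

/-! ### §2 The open `a × b` cluster (any sides) -/

section OpenBox

variable {a b : ℕ}

/-- `(-1)^u = -(-1)^v` in `ℤˣ` when `u + v` is odd. [folklore] -/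
private theorem neg_one_pow_eq_neg_of_odd_add' {u v : ℕ} (h : Odd (u + v)) :
    ((-1 : ℤˣ) ^ u) = -(-1) ^ v := by
  have h1 : ((-1 : ℤˣ) ^ u * (-1) ^ v) = -1 := by
    rw [← uzpow_add]; exact h.neg_one_pow
  have h2 : ((-1 : ℤˣ) ^ v * (-1) ^ v) = 1 := by
    rw [← uzpow_add]; exact Even.neg_one_pow ⟨v, rfl⟩
  calc ((-1 : ℤˣ) ^ u) = (-1) ^ u * ((-1) ^ v * (-1) ^ v) := by rw [h2, mul_one]
    _ = ((-1) ^ u * (-1) ^ v) * (-1) ^ v := (mul_assoc _ _ _).symm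
    _ = -(-1) ^ v := by rw [h1, neg_one_mul]

/-- `(-1)^u = (-1)^v` in `ℤˣ` when `u + v` is even. [folklore] -/
private theorem neg_one_pow_eq_of_even_add' {u v : ℕ} (h : Even (u + v)) :
    ((-1 : ℤˣ) ^ u) = (-1) ^ v := by
  have h1 : ((-1 : ℤˣ) ^ u * (-1) ^ v) = 1 := by
    rw [← uzpow_add]; exact h.neg_one_pow
  have h2 : ((-1 : ℤˣ) ^ v * (-1) ^ v) = 1 := by
    rw [← uzpow_add]; exact Even.neg_one_pow ⟨v, rfl⟩
  calc ((-1 : ℤˣ) ^ u) = (-1) ^ u * ((-1) ^ v * (-1) ^ v) := by rw [h2, mul_one]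
    _ = ((-1) ^ u * (-1) ^ v) * (-1) ^ v := (mul_assoc _ _ _).symm
    _ = (-1) ^ v := by rw [h1, one_mul]

/-- **The open box is bipartite**: nearest neighbours of `rectBoxGraph a b` carry opposite staggering signs
`(-1)^{x+y}` (ANY sides — no wrap-around bonds). [cite: LiebPRL1989, Theorem 2 (bipartite lattice)] -/
theorem rectStagger_eq_neg_of_boxAdj {p q : Fin a ×ₗ Fin b} (h : (rectBoxGraph a b).Adj p q) :
    rectStagger a b p = -rectStagger a b q := by
  have hodd : Odd ((((ofLex p).1 : ℕ) + ((ofLex p).2 : ℕ)) + (((ofLex q).1 : ℕ) + ((ofLex q).2 : ℕ))) := by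
    rcases h with ⟨h2, h1⟩ | ⟨h1, h2⟩
    · have h2' : ((ofLex p).2 : ℕ) = ((ofLex q).2 : ℕ) := by rw [h2]
      rw [Nat.odd_iff]; unfold lineAdj at h1; omega
    · have h1' : ((ofLex p).1 : ℕ) = ((ofLex q).1 : ℕ) := by rw [h1]
      rw [Nat.odd_iff]; unfold lineAdj at h2; omega
  exact neg_one_pow_eq_neg_of_odd_add' hodd

/-- **The diagonal bonds of the open box join equal-sign sites**: `(-1)^{x+y}` is constant along every bond of
`rectBoxDiagGraph a b`. [cite: EsslerEtAl2005, §2.2.4 eqs. (2.59)–(2.61)] -/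
theorem rectStagger_eq_of_boxDiagAdj {p q : Fin a ×ₗ Fin b} (h : (rectBoxDiagGraph a b).Adj p q) :
    rectStagger a b p = rectStagger a b q := by
  have heven : Even ((((ofLex p).1 : ℕ) + ((ofLex p).2 : ℕ)) + (((ofLex q).1 : ℕ) + ((ofLex q).2 : ℕ))) := by
    obtain ⟨h1, h2⟩ := h
    rw [Nat.even_iff]; unfold lineAdj at h1 h2; omega
  exact neg_one_pow_eq_of_even_add' heven

/-- **Particle–hole conjugation of the open-cluster `t–t'` Hamiltonian** (free boundary conditions, ANY
sides `a, b`; staggered phases `(-1)^{x+y}`):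
`P H^{open}(t, t', U) Pᴴ = H^{open}(t, -t', U) - U N + U ab` — nearest-neighbour hopping invariant
(bipartite bonds), diagonal hopping changes sign (same-sign bonds), `n_{x↑}n_{x↓} ↦ (1 - n_{x↑})(1 - n_{x↓})`.
[cite: EsslerEtAl2005, §2.2.4 eqs. (2.59)–(2.61)] -/
theorem particleHole_hubbardOpenBoxTT' (a b : ℕ) (t t' U : ℝ) :
    particleHole (fun i : Orb (Fin a ×ₗ Fin b) => ((rectStagger a b (ofLex i).1 : ℤ) : ℂ)) *
        hubbardOpenBoxTT' a b t t' U *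
        (particleHole (fun i : Orb (Fin a ×ₗ Fin b) => ((rectStagger a b (ofLex i).1 : ℤ) : ℂ)))ᴴ =
      hubbardOpenBoxTT' a b t (-t') U - (U : ℂ) • totalNumber +
        ((U * (a * b) : ℝ) : ℂ) •
          (1 : Matrix (Finset (Orb (Fin a ×ₗ Fin b))) (Finset (Orb (Fin a ×ₗ Fin b))) ℂ) := by
  have hNN := hamiltonian_particleHole_bipartite_holds (rectBoxGraph a b) t U
    (rectStagger a b) (fun x y hxy => rectStagger_eq_neg_of_boxAdj hxy)
  have hNNN := hamiltonian_particleHole_sameSign (rectBoxDiagGraph a b) t' 0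
    (rectStagger a b) (fun x y hxy => rectStagger_eq_of_boxDiagAdj hxy)
  have hcard : Fintype.card (Fin a ×ₗ Fin b) = a * b := card_rectSites a b
  have key := congrArg₂ (· + ·) hNN hNNN
  simp only [zero_mul, Complex.ofReal_zero, zero_smul, sub_zero, add_zero] at key
  rw [← Matrix.add_mul, ← Matrix.mul_add, ← hubbardOpenBoxTT', add_right_comm,
    sub_add_eq_add_sub, ← hubbardOpenBoxTT', hcard] at key
  push_cast at key ⊢
  convert key

/-- **Uniform-sign particle–hole conjugation of the open-cluster `t–t'` Hamiltonian** (phases all `+1`, ANY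
sides): `P₀ H^{open}(t, t', U) P₀ᴴ = H^{open}(-t, -t', U) - U N + U ab` (every bond is a same-sign bond).
[cite: EsslerEtAl2005, §2.2.4 eqs. (2.59)–(2.61)] -/
theorem particleHole_uniform_hubbardOpenBoxTT' (a b : ℕ) (t t' U : ℝ) :
    particleHole (fun i : Orb (Fin a ×ₗ Fin b) => (((fun _ : Fin a ×ₗ Fin b => (1 : ℤˣ)) (ofLex i).1 : ℤ) : ℂ)) *
        hubbardOpenBoxTT' a b t t' U *
        (particleHole (fun i : Orb (Fin a ×ₗ Fin b) =>
          (((fun _ : Fin a ×ₗ Fin b => (1 : ℤˣ)) (ofLex i).1 : ℤ) : ℂ)))ᴴ =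
      hubbardOpenBoxTT' a b (-t) (-t') U - (U : ℂ) • totalNumber +
        ((U * (a * b) : ℝ) : ℂ) •
          (1 : Matrix (Finset (Orb (Fin a ×ₗ Fin b))) (Finset (Orb (Fin a ×ₗ Fin b))) ℂ) := by
  have hNN := hamiltonian_particleHole_sameSign (rectBoxGraph a b) t U
    (fun _ => (1 : ℤˣ)) (fun _ _ _ => rfl)
  have hNNN := hamiltonian_particleHole_sameSign (rectBoxDiagGraph a b) t' 0
    (fun _ => (1 : ℤˣ)) (fun _ _ _ => rfl)
  have hcard : Fintype.card (Fin a ×ₗ Fin b) = a * b := card_rectSites a b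
  have key := congrArg₂ (· + ·) hNN hNNN
  simp only [zero_mul, Complex.ofReal_zero, zero_smul, sub_zero, add_zero] at key
  rw [← Matrix.add_mul, ← Matrix.mul_add, ← hubbardOpenBoxTT', add_right_comm,
    sub_add_eq_add_sub, ← hubbardOpenBoxTT', hcard] at key
  push_cast at key ⊢
  convert key

/-- **Canonical partition functions of the open `a × b` `t–t'` cluster under particle–hole conjugation** (ANY
sides, every `β`): for `p + p' = q + q' = ab`,
`Z_β(H^{open}_{a×b}(t, t', U); p, q) = e^{βU(ab - p - q)} · Z_β(H^{open}_{a×b}(t, -t', U); p', q')` — HOLE doping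
at `t'` is ELECTRON doping at `-t'`, at every temperature. [cite: LiebWuPhysicaA2003, §1 eq. (3)] -/
theorem partitionFn_spinSector_hubbardOpenBoxTT'_particleHole (a b : ℕ) (β t t' U : ℝ) {p q p' q' : ℕ}
    (hp : p + p' = a * b) (hq : q + q' = a * b) :
    partitionFn β (spinSectorHamiltonian p q (hubbardOpenBoxTT' a b t t' U)) =
      (Real.exp (β * U * ((a : ℝ) * b - p - q)) : ℂ) *
        partitionFn β (spinSectorHamiltonian p' q' (hubbardOpenBoxTT' a b t (-t') U)) := by
  have hcard : Fintype.card (Fin a ×ₗ Fin b) = a * b := card_rectSites a b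
  have hn : ∀ i : Orb (Fin a ×ₗ Fin b), ‖((rectStagger a b (ofLex i).1 : ℤ) : ℂ)‖ = 1 :=
    fun i => norm_intCast_units _
  rw [partitionFn_spinSectorHamiltonian_particleHole_transfer _ hn (particleHole_hubbardOpenBoxTT' a b t t' U)
    (by rw [hcard]; exact hp) (by rw [hcard]; exact hq) β]
  congr 2
  have hp' : (p' : ℝ) = a * b - p := by
    have := congrArg (fun n : ℕ => (n : ℝ)) hp; push_cast at this; linarith
  have hq' : (q' : ℝ) = a * b - q := by
    have := congrArg (fun n : ℕ => (n : ℝ)) hq; push_cast at this; linarith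
  rw [hp', hq']
  ring

/-- Real-part form: `Re Z_β(H^{open}(t, t', U); p, q) = e^{βU(ab - p - q)} · Re Z_β(H^{open}(t, -t', U); p', q')`.
[cite: LiebWuPhysicaA2003, §1 eq. (3)] -/
theorem partitionFn_spinSector_hubbardOpenBoxTT'_particleHole_re (a b : ℕ) (β t t' U : ℝ) {p q p' q' : ℕ}
    (hp : p + p' = a * b) (hq : q + q' = a * b) :
    (partitionFn β (spinSectorHamiltonian p q (hubbardOpenBoxTT' a b t t' U))).re =
      Real.exp (β * U * ((a : ℝ) * b - p - q)) *
        (partitionFn β (spinSectorHamiltonian p' q' (hubbardOpenBoxTT' a b t (-t') U))).re := by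
  rw [partitionFn_spinSector_hubbardOpenBoxTT'_particleHole a b β t t' U hp hq, Complex.re_ofReal_mul]

/-- **Floor transfer (the consumer form).** A certified floor `z ≤ Re Z_β(H^{open}_{a×b}(t, -t', U); p', q')` on a
HOLE-doped sector of the `-t'` cluster is the certified floor
`e^{βU(ab - p - q)} · z ≤ Re Z_β(H^{open}_{a×b}(t, t', U); p, q)` on the ELECTRON-doped sector `(p, q) =
(ab - p', ab - q')` of the `t'` cluster — the `hz` input of `TorusSectorPressureTypeBoundAllTori` for the
reflected type. [cite: LiebWuPhysicaA2003, §1 eq. (3)] -/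
theorem mul_le_partitionFn_spinSector_hubbardOpenBoxTT'_re_of_particleHole (a b : ℕ) (β t t' U : ℝ)
    {p q p' q' : ℕ} (hp : p + p' = a * b) (hq : q + q' = a * b) {z : ℝ}
    (hz : z ≤ (partitionFn β (spinSectorHamiltonian p' q' (hubbardOpenBoxTT' a b t (-t') U))).re) :
    Real.exp (β * U * ((a : ℝ) * b - p - q)) * z ≤
      (partitionFn β (spinSectorHamiltonian p q (hubbardOpenBoxTT' a b t t' U))).re := by
  rw [partitionFn_spinSector_hubbardOpenBoxTT'_particleHole_re a b β t t' U hp hq]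
  exact mul_le_mul_of_nonneg_left hz (Real.exp_pos _).le

/-- **Uniform-sign transfer**: `Z_β(H^{open}(t, t', U); p, q) = e^{βU(ab - p - q)} · Z_β(H^{open}(-t, -t', U); p', q')`
for `p + p' = q + q' = ab` (ANY sides). [cite: EsslerEtAl2005, §2.2.4 eqs. (2.59)–(2.61)] -/
theorem partitionFn_spinSector_hubbardOpenBoxTT'_particleHole_uniform (a b : ℕ) (β t t' U : ℝ)
    {p q p' q' : ℕ} (hp : p + p' = a * b) (hq : q + q' = a * b) :
    partitionFn β (spinSectorHamiltonian p q (hubbardOpenBoxTT' a b t t' U)) =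
      (Real.exp (β * U * ((a : ℝ) * b - p - q)) : ℂ) *
        partitionFn β (spinSectorHamiltonian p' q' (hubbardOpenBoxTT' a b (-t) (-t') U)) := by
  have hcard : Fintype.card (Fin a ×ₗ Fin b) = a * b := card_rectSites a b
  have hn : ∀ i : Orb (Fin a ×ₗ Fin b),
      ‖(((fun _ : Fin a ×ₗ Fin b => (1 : ℤˣ)) (ofLex i).1 : ℤ) : ℂ)‖ = 1 :=
    fun i => norm_intCast_units _
  rw [partitionFn_spinSectorHamiltonian_particleHole_transfer _ hn
    (particleHole_uniform_hubbardOpenBoxTT' a b t t' U) (by rw [hcard]; exact hp) (by rw [hcard]; exact hq) β]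
  congr 2
  have hp' : (p' : ℝ) = a * b - p := by
    have := congrArg (fun n : ℕ => (n : ℝ)) hp; push_cast at this; linarith
  have hq' : (q' : ℝ) = a * b - q := by
    have := congrArg (fun n : ℕ => (n : ℝ)) hq; push_cast at this; linarith
  rw [hp', hq']
  ring

/-- **The sign of the nearest-neighbour hopping is immaterial for every canonical partition function of the
open cluster** (ANY sides, every sector, every `β`): `Z_β(H^{open}(-t, t', U); p, q) = Z_β(H^{open}(t, t', U); p, q)`
— the staggered conjugation followed by the uniform one is the gauge `c_{xσ} ↦ (-1)^{x+y} c_{xσ}`, which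
flips the nearest-neighbour bonds, fixes the diagonal bonds and every spin sector.
[cite: EsslerEtAl2005, §2.2.4 eqs. (2.59)–(2.61)] -/
theorem partitionFn_spinSector_hubbardOpenBoxTT'_neg_t (a b : ℕ) (β t t' U : ℝ) {p q : ℕ}
    (hp : p ≤ a * b) (hq : q ≤ a * b) :
    partitionFn β (spinSectorHamiltonian p q (hubbardOpenBoxTT' a b (-t) t' U)) =
      partitionFn β (spinSectorHamiltonian p q (hubbardOpenBoxTT' a b t t' U)) := by
  have hp' : p + (a * b - p) = a * b := by omega
  have hq' : q + (a * b - q) = a * b := by omega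
  rw [partitionFn_spinSector_hubbardOpenBoxTT'_particleHole a b β (-t) t' U hp' hq',
    partitionFn_spinSector_hubbardOpenBoxTT'_particleHole_uniform a b β t t' U hp' hq']

end OpenBox

/-! ### §3 Tori with even sides -/

section RectTorus

variable {a b : ℕ}

/-- **Canonical partition functions of the rectangular `t–t'` torus under particle–hole conjugation** (`a, b`
even): `Z_β(H_{a×b}(t, t', U); p, q) = e^{βU(ab - p - q)} · Z_β(H_{a×b}(t, -t', U); p', q')`, `p + p' = q + q' = ab`.
[cite: LiebWuPhysicaA2003, §1 eq. (3)] -/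
theorem partitionFn_spinSector_hubbardRectTorusTT'_particleHole (ha : Even a) (hb : Even b)
    (β t t' U : ℝ) {p q p' q' : ℕ} (hp : p + p' = a * b) (hq : q + q' = a * b) :
    partitionFn β (spinSectorHamiltonian p q (hubbardRectTorusTT' a b t t' U)) =
      (Real.exp (β * U * ((a : ℝ) * b - p - q)) : ℂ) *
        partitionFn β (spinSectorHamiltonian p' q' (hubbardRectTorusTT' a b t (-t') U)) := by
  have hcard : Fintype.card (Fin a ×ₗ Fin b) = a * b := card_rectSites a b
  have hn : ∀ i : Orb (Fin a ×ₗ Fin b), ‖((rectStagger a b (ofLex i).1 : ℤ) : ℂ)‖ = 1 :=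
    fun i => norm_intCast_units _
  rw [partitionFn_spinSectorHamiltonian_particleHole_transfer _ hn (particleHole_hubbardRectTorusTT' ha hb t t' U)
    (by rw [hcard]; exact hp) (by rw [hcard]; exact hq) β]
  congr 2
  have hp' : (p' : ℝ) = a * b - p := by
    have := congrArg (fun n : ℕ => (n : ℝ)) hp; push_cast at this; linarith
  have hq' : (q' : ℝ) = a * b - q := by
    have := congrArg (fun n : ℕ => (n : ℝ)) hq; push_cast at this; linarith
  rw [hp', hq']
  ring

/-- Real-part form on the rectangular torus. [cite: LiebWuPhysicaA2003, §1 eq. (3)] -/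
theorem partitionFn_spinSector_hubbardRectTorusTT'_particleHole_re (ha : Even a) (hb : Even b)
    (β t t' U : ℝ) {p q p' q' : ℕ} (hp : p + p' = a * b) (hq : q + q' = a * b) :
    (partitionFn β (spinSectorHamiltonian p q (hubbardRectTorusTT' a b t t' U))).re =
      Real.exp (β * U * ((a : ℝ) * b - p - q)) *
        (partitionFn β (spinSectorHamiltonian p' q' (hubbardRectTorusTT' a b t (-t') U))).re := by
  rw [partitionFn_spinSector_hubbardRectTorusTT'_particleHole ha hb β t t' U hp hq, Complex.re_ofReal_mul]

end RectTorus

section SquareTorus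

variable {L : ℕ}

/-- **Canonical partition functions of the square `t–t'` torus under particle–hole conjugation** (`L` even):
`Z_β(H_L(t, t', U); p, q) = e^{βU(L² - p - q)} · Z_β(H_L(t, -t', U); p', q')`, `p + p' = q + q' = L²` (the square
torus `(ℤ/Lℤ)²` is the rectangular torus `L × L`, `partitionFn_spinSector_hubbardTorusTT'_eq_rect`).
[cite: LiebWuPhysicaA2003, §1 eq. (3)] -/
theorem partitionFn_spinSector_hubbardTorusTT'_particleHole (hL : Even L) (β t t' U : ℝ)
    {p q p' q' : ℕ} (hp : p + p' = L ^ 2) (hq : q + q' = L ^ 2) :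
    partitionFn β (spinSectorHamiltonian p q (hubbardTorusTT' L t t' U)) =
      (Real.exp (β * U * ((L : ℝ) ^ 2 - p - q)) : ℂ) *
        partitionFn β (spinSectorHamiltonian p' q' (hubbardTorusTT' L t (-t') U)) := by
  have hp2 : p + p' = L * L := by rw [← sq]; exact hp
  have hq2 : q + q' = L * L := by rw [← sq]; exact hq
  rw [partitionFn_spinSector_hubbardTorusTT'_eq_rect, partitionFn_spinSector_hubbardTorusTT'_eq_rect,
    partitionFn_spinSector_hubbardRectTorusTT'_particleHole hL hL β t t' U hp2 hq2]
  congr 2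
  ring

/-- Real-part form on the square torus. [cite: LiebWuPhysicaA2003, §1 eq. (3)] -/
theorem partitionFn_spinSector_hubbardTorusTT'_particleHole_re (hL : Even L) (β t t' U : ℝ)
    {p q p' q' : ℕ} (hp : p + p' = L ^ 2) (hq : q + q' = L ^ 2) :
    (partitionFn β (spinSectorHamiltonian p q (hubbardTorusTT' L t t' U))).re =
      Real.exp (β * U * ((L : ℝ) ^ 2 - p - q)) *
        (partitionFn β (spinSectorHamiltonian p' q' (hubbardTorusTT' L t (-t') U))).re := by
  rw [partitionFn_spinSector_hubbardTorusTT'_particleHole hL β t t' U hp hq, Complex.re_ofReal_mul]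

/-- `halfRectN n L ≤ L²` for `0 ≤ n ≤ 2`. [folklore] -/
private theorem halfRectN_le_sq' {n : ℝ} (hn0 : 0 ≤ n) (hn2 : n ≤ 2) (L : ℕ) : halfRectN n L ≤ L ^ 2 := by
  have h := ThermodynamicLimit.rectN_le_two_mul hn0 hn2 L
  have h2 : rectN n L = 2 * halfRectN n L := rfl
  rw [h2] at h
  rw [sq]
  omega

/-- **The canonical partition function of record under particle–hole conjugation** (`L` even, `0 ≤ n ≤ 2`,
`k = halfRectN n L`): `Z_β(sectorHamiltonianTT' t t' U n L) = e^{βU(L² - 2k)} · Z_β(H_L(t, -t', U); L² - k, L² - k)`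
— the image is the spin sector `(L² - k, L² - k)` of the `-t'` torus (the sector of record at density `2 - n`
exactly when `nL²/2 ∈ ℤ`, next lemma). [cite: LiebWuPhysicaA2003, §1 eq. (3)] -/
theorem partitionFn_sectorHamiltonianTT'_particleHole (hL : Even L) (β t t' U : ℝ) {n : ℝ} (hn0 : 0 ≤ n)
    (hn2 : n ≤ 2) :
    partitionFn β (sectorHamiltonianTT' t t' U n L) =
      (Real.exp (β * U * ((L : ℝ) ^ 2 - 2 * halfRectN n L)) : ℂ) *
        partitionFn β (spinSectorHamiltonian (L ^ 2 - halfRectN n L) (L ^ 2 - halfRectN n L)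
          (hubbardTorusTT' L t (-t') U)) := by
  have hk := halfRectN_le_sq' hn0 hn2 L
  have hk' : halfRectN n L + (L ^ 2 - halfRectN n L) = L ^ 2 := by omega
  rw [partitionFn_sectorHamiltonianTT'_eq_spinSector,
    partitionFn_spinSector_hubbardTorusTT'_particleHole hL β t t' U hk' hk']
  congr 2
  ring

/-- **Record-to-record form**: when the two sectors of record are complementary
(`halfRectN n L + halfRectN (2 - n) L = L²`, i.e. `nL²/2 ∈ ℤ` — e.g. `n = 7/8` and `4 ∣ L`), then for `L` even
`Z_β(sectorHamiltonianTT' t t' U n L) = e^{βU(L² - 2·halfRectN n L)} · Z_β(sectorHamiltonianTT' t (-t') U (2 - n) L)`.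
[cite: LiebWuPhysicaA2003, §1 eq. (3)] -/
theorem partitionFn_sectorHamiltonianTT'_particleHole_of_add (hL : Even L) (β t t' U : ℝ) {n : ℝ}
    (hk : halfRectN n L + halfRectN (2 - n) L = L ^ 2) :
    partitionFn β (sectorHamiltonianTT' t t' U n L) =
      (Real.exp (β * U * ((L : ℝ) ^ 2 - 2 * halfRectN n L)) : ℂ) *
        partitionFn β (sectorHamiltonianTT' t (-t') U (2 - n) L) := by
  rw [partitionFn_sectorHamiltonianTT'_eq_spinSector, partitionFn_sectorHamiltonianTT'_eq_spinSector,
    partitionFn_spinSector_hubbardTorusTT'_particleHole hL β t t' U hk hk]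
  congr 2
  ring

end SquareTorus

end Literature.MathematicalPhysics.QuantumLattice
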